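import Summits.ValiantsHypothesis.ValiantsHypothesis.Theorems.FeketeSOSFeketeSOSHardPaleyRIPHankelBilinear

/-!
# Route FeketeSOS — crux `FeketeSOSHard` (stmt-ValiantsHypothesis-3996), line `paley-rip` (v3),
# stub `stub_paleyFlatRIP`: the Paley graph property below `1/2` for vertex sets inside short intervals,
# conditionally on the mixed Burgess bound

The registered engine is equivalent (g0/g2: `flatRIP_iff_paleyGraphConjectureBelowHalf`) to the Paley graph
conjecture below `1/2`: `|Σ_{a∈A,b∈B} χ_p(a−b)| ≤ p^{−β}#A#B` for all `A, B ⊆ 𝔽_p` of size `≥ p^α`, some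
`α < 1/2` — open since Chor–Goldreich 1988.  Here the same property is PROVED for vertex sets inside short
intervals, conditionally on the published Burgess bound for character sums with a linear phase
(`Literature.NumberTheory.GaussSums.BurgessBoundLinearPhase`, Heath-Brown–Pierce 2015 Thm 1.4):

* `mixedBound_of_burgessBoundLinearPhase` — the exponent bookkeeping once: with `r = 3`, for
  `κ + (2/3)δ₁ < 1/24` and `p` large, every mixed sum of length `2N − 1`, `N ≤ p^{1/2+δ₁}`, is `≤ p^{1/2−κ}`;
* `paleyGraphBilin_intervals_of_burgessBoundLinearPhase` — `|Σ_{a∈S₁,b∈S₂} χ_p(a−b) u_a v_b| ≤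
  p^{1/2−κ}‖u‖₂‖v‖₂` for all `S₁ ⊆ [x₁,x₁+N)`, `S₂ ⊆ [x₂,x₂+N)`, `N ≤ p^{1/2+δ₁}`, all complex `u, v`;
* `paleyGraph_subpairs_intervals_of_burgessBoundLinearPhase` — the flat form: `|Σ_{A×B} χ_p(a−b)| ≤
  p^{1/2−κ}√(#A#B)` for ALL `A ⊆ [x₁,x₁+N)`, `B ⊆ [x₂,x₂+N)` — a power saving beyond `√p` in the balanced
  range `#A, #B ≍ p^{1/2+δ₁}`, `δ₁ < 1/16`, for arbitrary sub-pairs of two short intervals;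
* `paleySum_subpairs_two_intervals_of_burgessBoundLinearPhase` — the same for the sum kernel `χ_p(a+b)`.

Honest framing (rung currency): Theorems-side helper `--supports` stmt-3996, CONDITIONAL on the named fact;
the interval restriction is essential (general vertex sets = the open conjecture = the stub);
`stub_tameOperator` and the crux stay OPEN; `VP ≠ VNP` is untouched.
-/

set_option linter.dupNamespace false

namespace Summit.ValiantsHypothesis.ValiantsHypothesis.Theorems.FeketeSOSHardPaleyRIP

open Finset Complex
open scoped BigOperators ZMod Real

noncomputable section

section Conditional

/-- **Mixed sums of length `≍ p^{1/2+δ₁}` save `p^κ` over `√p`** under `BurgessBoundLinearPhase` (`r = 3`):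
for `δ₁ > 0`, `κ + (2/3)δ₁ < 1/24` there is `p₁ ≥ 3` such that for all primes `p ≥ p₁`, all `N ≤ p^{1/2+δ₁}`,
all real `θ` and integers `N'`, `|Σ_{N'<n≤N'+2N−1} e(θn)χ_p(n)| ≤ p^{1/2−κ}`. [folklore] -/
theorem mixedBound_of_burgessBoundLinearPhase
    (hBurgess : Literature.NumberTheory.GaussSums.BurgessBoundLinearPhase)
    (κ δ₁ : ℝ) (hκ : 0 < κ) (hδ₁ : 0 < δ₁) (hgap : κ + 2 * δ₁ / 3 < 1 / 24) :
    ∃ p₁ : ℕ, 3 ≤ p₁ ∧ ∀ (p : ℕ) [Fact p.Prime], p₁ ≤ p → ∀ (N : ℕ), (N : ℝ) ≤ (p : ℝ) ^ (1 / 2 + δ₁) →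
      ∀ (θ : ℝ) (N' : ℤ), ‖∑ n ∈ Finset.Ioc N' (N' + (2 * N - 1 : ℕ)),
        Complex.exp (2 * π * I * θ * n) *
          (quadraticChar (ZMod p)).ringHomComp (Int.castRingHom ℂ) (n : ZMod p)‖ ≤
        (p : ℝ) ^ (1 / 2 - κ) := by
  set g : ℝ := 1 / 24 - κ - 2 * δ₁ / 3 with hg
  have hgpos : 0 < g := by rw [hg]; linarith
  set ε : ℝ := g / 2 with hε
  have hεpos : 0 < ε := by rw [hε]; linarith
  obtain ⟨C, hC, hB⟩ := hBurgess 3 (by norm_num) ε hεpos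
  set C' : ℝ := C * (2 : ℝ) ^ (2 / 3 : ℝ) with hC'
  have hC'pos : 0 < C' := mul_pos hC (Real.rpow_pos_of_pos (by norm_num) _)
  set t : ℝ := 1 / 8 - δ₁ with ht
  have htpos : 0 < t := by rw [ht]; linarith
  refine ⟨⌈(2 : ℝ) ^ (1 / t)⌉₊ + ⌈C' ^ (1 / ε)⌉₊ + 3, by omega, ?_⟩
  intro p _ hp N hN θ N'
  have hp3 : 3 ≤ p := le_trans (by omega) hp
  have hp2 : p ≠ 2 := by omega
  have hp0 : (0 : ℝ) < (p : ℝ) := by exact_mod_cast (Fact.out : p.Prime).pos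
  have hpR : ((⌈(2 : ℝ) ^ (1 / t)⌉₊ + ⌈C' ^ (1 / ε)⌉₊ + 3 : ℕ) : ℝ) ≤ (p : ℝ) := by exact_mod_cast hp
  push_cast at hpR
  have h2t : (2 : ℝ) < (p : ℝ) ^ t := by
    refine lt_rpow_of_rpow_inv_lt (by norm_num) htpos ?_
    have := Nat.le_ceil ((2 : ℝ) ^ (1 / t)); linarith
  have hC'le : C' ≤ (p : ℝ) ^ ε := by
    refine le_rpow_of_rpow_inv_le hC'pos hεpos ?_
    have := Nat.le_ceil (C' ^ (1 / ε)); linarith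
  have hψ : (quadraticChar (ZMod p)).ringHomComp (Int.castRingHom ℂ) ≠ 1 :=
    Literature.NumberTheory.GaussSums.quadraticChar_ringHomComp_ne_one hp2
  have hH2 : ((2 * N - 1 : ℕ) : ℝ) ≤ 2 * (N : ℝ) := by
    have : (2 * N - 1 : ℕ) ≤ 2 * N := Nat.sub_le _ _
    exact_mod_cast this
  have hH : ((2 * N - 1 : ℕ) : ℝ) ≤ 2 * (p : ℝ) ^ (1 / 2 + δ₁) := hH2.trans (by linarith)
  have hpow : (0 : ℝ) < (p : ℝ) ^ (1 / 2 + δ₁) := Real.rpow_pos_of_pos hp0 _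
  have hrange : ((2 * N - 1 : ℕ) : ℝ) < (p : ℝ) ^ (1 / 2 + 1 / (4 * (((3 : ℕ) : ℝ) - 1))) := by
    have h58 : (1 : ℝ) / 2 + 1 / (4 * (((3 : ℕ) : ℝ) - 1)) = t + (1 / 2 + δ₁) := by
      rw [ht]; norm_num
    rw [h58, Real.rpow_add hp0]
    calc ((2 * N - 1 : ℕ) : ℝ) ≤ 2 * (p : ℝ) ^ (1 / 2 + δ₁) := hH
      _ < (p : ℝ) ^ t * (p : ℝ) ^ (1 / 2 + δ₁) := mul_lt_mul_of_pos_right h2t hpow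
  have hmain := hB p _ hψ θ N' (2 * N - 1) hrange
  refine hmain.trans ?_
  have h23 : (1 : ℝ) - 1 / ((3 : ℕ) : ℝ) = 2 / 3 := by norm_num
  have h18 : 1 / (4 * (((3 : ℕ) : ℝ) - 1)) + ε = 1 / 8 + ε := by norm_num
  rw [h23, h18]
  have hH0 : (0 : ℝ) ≤ ((2 * N - 1 : ℕ) : ℝ) := Nat.cast_nonneg _
  have hHpow : ((2 * N - 1 : ℕ) : ℝ) ^ (2 / 3 : ℝ) ≤
      (2 : ℝ) ^ (2 / 3 : ℝ) * (p : ℝ) ^ ((1 / 2 + δ₁) * (2 / 3)) := by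
    calc ((2 * N - 1 : ℕ) : ℝ) ^ (2 / 3 : ℝ) ≤ (2 * (p : ℝ) ^ (1 / 2 + δ₁)) ^ (2 / 3 : ℝ) :=
          Real.rpow_le_rpow hH0 hH (by norm_num)
      _ = (2 : ℝ) ^ (2 / 3 : ℝ) * ((p : ℝ) ^ (1 / 2 + δ₁)) ^ (2 / 3 : ℝ) :=
          Real.mul_rpow (by norm_num) hpow.le
      _ = (2 : ℝ) ^ (2 / 3 : ℝ) * (p : ℝ) ^ ((1 / 2 + δ₁) * (2 / 3)) := by
          rw [← Real.rpow_mul hp0.le]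
  have hexp : (1 / 2 + δ₁) * (2 / 3) + (1 / 8 + ε) = (1 / 2 - κ) - ε := by
    rw [hε, hg]; ring
  have hp18 : (0 : ℝ) ≤ (p : ℝ) ^ (1 / 8 + ε) := Real.rpow_nonneg hp0.le _
  calc C * ((2 * N - 1 : ℕ) : ℝ) ^ (2 / 3 : ℝ) * (p : ℝ) ^ (1 / 8 + ε)
      ≤ C * ((2 : ℝ) ^ (2 / 3 : ℝ) * (p : ℝ) ^ ((1 / 2 + δ₁) * (2 / 3))) * (p : ℝ) ^ (1 / 8 + ε) :=
        mul_le_mul_of_nonneg_right (mul_le_mul_of_nonneg_left hHpow hC.le) hp18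
    _ = C' * (p : ℝ) ^ ((1 / 2 + δ₁) * (2 / 3) + (1 / 8 + ε)) := by
        have hsplit : (p : ℝ) ^ ((1 / 2 + δ₁) * (2 / 3) + (1 / 8 + ε)) =
            (p : ℝ) ^ ((1 / 2 + δ₁) * (2 / 3)) * (p : ℝ) ^ (1 / 8 + ε) := Real.rpow_add hp0 _ _
        rw [hsplit, hC']; ring
    _ = C' * ((p : ℝ) ^ (1 / 2 - κ) / (p : ℝ) ^ ε) := by
        rw [hexp, Real.rpow_sub hp0]
    _ ≤ (p : ℝ) ^ ε * ((p : ℝ) ^ (1 / 2 - κ) / (p : ℝ) ^ ε) :=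
        mul_le_mul_of_nonneg_right hC'le
          (div_nonneg (Real.rpow_nonneg hp0.le _) (Real.rpow_nonneg hp0.le _))
    _ = (p : ℝ) ^ (1 / 2 - κ) := by
        have hpε : (0 : ℝ) < (p : ℝ) ^ ε := Real.rpow_pos_of_pos hp0 _
        field_simp

variable (p : ℕ) [Fact p.Prime]

omit [Fact p.Prime] in
/-- **Paley graph property for vertex sets inside short intervals, weighted form** (conditional on
`BurgessBoundLinearPhase`): for `δ₁ > 0`, `κ + (2/3)δ₁ < 1/24` and all large primes `p`,
`|Σ_{a∈S₁,b∈S₂} χ_p(a−b) u_a v_b| ≤ p^{1/2−κ}‖u‖₂‖v‖₂` whenever `S₁ ⊆ [x₁,x₁+N)`, `S₂ ⊆ [x₂,x₂+N)`,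
`N ≤ p^{1/2+δ₁}`. [cite: HeathBrownPierce2015, Thm 1.4] -/
theorem paleyGraphBilin_intervals_of_burgessBoundLinearPhase
    (hBurgess : Literature.NumberTheory.GaussSums.BurgessBoundLinearPhase)
    (κ δ₁ : ℝ) (hκ : 0 < κ) (hδ₁ : 0 < δ₁) (hgap : κ + 2 * δ₁ / 3 < 1 / 24) :
    ∃ p₁ : ℕ, ∀ (p : ℕ) [Fact p.Prime], p₁ ≤ p → ∀ (x₁ x₂ N : ℕ), (N : ℝ) ≤ (p : ℝ) ^ (1 / 2 + δ₁) →
      ∀ (S₁ S₂ : Finset ℕ), (∀ a ∈ S₁, x₁ ≤ a ∧ a < x₁ + N) → (∀ b ∈ S₂, x₂ ≤ b ∧ b < x₂ + N) →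
      ∀ (u v : ℕ → ℂ),
        ‖∑ a ∈ S₁, ∑ b ∈ S₂, ((legendreSym p ((a : ℤ) - b) : ℤ) : ℂ) * u a * v b‖ ≤
          (p : ℝ) ^ (1 / 2 - κ) * Real.sqrt (∑ a ∈ S₁, ‖u a‖ ^ 2) * Real.sqrt (∑ b ∈ S₂, ‖v b‖ ^ 2) := by
  obtain ⟨p₁, hp₁3, h⟩ := mixedBound_of_burgessBoundLinearPhase hBurgess κ δ₁ hκ hδ₁ hgap
  refine ⟨p₁, fun p _ hp x₁ x₂ N hN S₁ S₂ hS₁ hS₂ u v => ?_⟩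
  have hp2 : p ≠ 2 := by omega
  rcases Nat.eq_zero_or_pos N with hN0 | hNpos
  · subst hN0
    have h1 : S₁ = ∅ := Finset.eq_empty_of_forall_notMem fun a ha => by have := hS₁ a ha; omega
    subst h1
    simp only [Finset.sum_empty, norm_zero, Real.sqrt_zero, mul_zero, zero_mul, le_refl]
  · haveI : NeZero (2 * N - 1) := ⟨by omega⟩
    refine norm_paleyDiffBilin_le_of_intervals p S₁ S₂ x₁ x₂ N hS₁ hS₂ (2 * N - 1) (by omega)
      (fun z => if z.val + 2 ≤ 2 * N then
        ((legendreSym p (((x₁ : ℤ) - x₂ - N + 1) + (z.val : ℤ)) : ℤ) : ℂ) else 0) ?_ _ ?_ u v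
    · intro s hs
      have hv : ((s : ℕ) : ZMod (2 * N - 1)).val = s := by
        rw [ZMod.val_natCast, Nat.mod_eq_of_lt (by omega)]
      simp only [hv, if_pos hs]
    · intro k
      rw [dft_truncatedKernel p ((x₁ : ℤ) - x₂ - N + 1) N (2 * N - 1) (by omega) k]
      exact norm_twistedSum_offset_le_of_mixedBound p hp2 _ (2 * N - 1) (2 * N - 1) k _ (h p hp N hN)

omit [Fact p.Prime] in
/-- **Paley graph property below `1/2` for ALL sub-pairs of two short intervals** (conditional on
`BurgessBoundLinearPhase`): for `δ₁ > 0`, `κ + (2/3)δ₁ < 1/24` and all large primes `p`, for every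
`N ≤ p^{1/2+δ₁}` and ALL `A ⊆ [x₁, x₁+N)`, `B ⊆ [x₂, x₂+N)`:
`|Σ_{a∈A, b∈B} χ_p(a − b)| ≤ p^{1/2−κ} · √(#A · #B)` — non-trivial (beyond the completion bound `√(p#A#B)`)
as soon as `#A#B > p^{1−2κ}`.  For general `A, B ⊆ 𝔽_p` this is the Paley graph conjecture, open.
[cite: HeathBrownPierce2015, Thm 1.4] -/
theorem paleyGraph_subpairs_intervals_of_burgessBoundLinearPhase
    (hBurgess : Literature.NumberTheory.GaussSums.BurgessBoundLinearPhase)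
    (κ δ₁ : ℝ) (hκ : 0 < κ) (hδ₁ : 0 < δ₁) (hgap : κ + 2 * δ₁ / 3 < 1 / 24) :
    ∃ p₁ : ℕ, ∀ (p : ℕ) [Fact p.Prime], p₁ ≤ p → ∀ (x₁ x₂ N : ℕ), (N : ℝ) ≤ (p : ℝ) ^ (1 / 2 + δ₁) →
      ∀ (A B : Finset ℕ), A ⊆ Finset.Ico x₁ (x₁ + N) → B ⊆ Finset.Ico x₂ (x₂ + N) →
        ‖∑ a ∈ A, ∑ b ∈ B, ((legendreSym p ((a : ℤ) - b) : ℤ) : ℂ)‖ ≤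
          (p : ℝ) ^ (1 / 2 - κ) * Real.sqrt ((A.card : ℝ) * B.card) := by
  obtain ⟨p₁, h⟩ := paleyGraphBilin_intervals_of_burgessBoundLinearPhase hBurgess κ δ₁ hκ hδ₁ hgap
  refine ⟨p₁, fun p _ hp x₁ x₂ N hN A B hA hB => ?_⟩
  have h1 := h p hp x₁ x₂ N hN A B (fun a ha => Finset.mem_Ico.1 (hA ha)) (fun b hb => Finset.mem_Ico.1 (hB hb))
    (fun _ => 1) (fun _ => 1)
  simp only [mul_one, norm_one, one_pow, Finset.sum_const, nsmul_eq_mul] at h1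
  rw [Real.sqrt_mul (Nat.cast_nonneg _), ← mul_assoc]
  simpa using h1

omit [Fact p.Prime] in
/-- **Sum kernel on two short intervals, weighted form** (conditional on `BurgessBoundLinearPhase`):
`|Σ_{a∈S₁,b∈S₂} χ_p(a+b) u_a v_b| ≤ p^{1/2−κ}‖u‖₂‖v‖₂` for `S₁ ⊆ [x₁,x₁+N)`, `S₂ ⊆ [x₂,x₂+N)`,
`N ≤ p^{1/2+δ₁}`, `p` large. [cite: HeathBrownPierce2015, Thm 1.4] -/
theorem paleySumBilin_two_intervals_of_burgessBoundLinearPhase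
    (hBurgess : Literature.NumberTheory.GaussSums.BurgessBoundLinearPhase)
    (κ δ₁ : ℝ) (hκ : 0 < κ) (hδ₁ : 0 < δ₁) (hgap : κ + 2 * δ₁ / 3 < 1 / 24) :
    ∃ p₁ : ℕ, ∀ (p : ℕ) [Fact p.Prime], p₁ ≤ p → ∀ (x₁ x₂ N : ℕ), (N : ℝ) ≤ (p : ℝ) ^ (1 / 2 + δ₁) →
      ∀ (S₁ S₂ : Finset ℕ), (∀ a ∈ S₁, x₁ ≤ a ∧ a < x₁ + N) → (∀ b ∈ S₂, x₂ ≤ b ∧ b < x₂ + N) →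
      ∀ (u v : ℕ → ℂ),
        ‖∑ a ∈ S₁, ∑ b ∈ S₂, ((legendreSym p ((a : ℤ) + b) : ℤ) : ℂ) * u a * v b‖ ≤
          (p : ℝ) ^ (1 / 2 - κ) * Real.sqrt (∑ a ∈ S₁, ‖u a‖ ^ 2) * Real.sqrt (∑ b ∈ S₂, ‖v b‖ ^ 2) := by
  obtain ⟨p₁, hp₁3, h⟩ := mixedBound_of_burgessBoundLinearPhase hBurgess κ δ₁ hκ hδ₁ hgap
  refine ⟨p₁, fun p _ hp x₁ x₂ N hN S₁ S₂ hS₁ hS₂ u v => ?_⟩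
  have hp2 : p ≠ 2 := by omega
  rcases Nat.eq_zero_or_pos N with hN0 | hNpos
  · subst hN0
    have h1 : S₁ = ∅ := Finset.eq_empty_of_forall_notMem fun a ha => by have := hS₁ a ha; omega
    subst h1
    simp only [Finset.sum_empty, norm_zero, Real.sqrt_zero, mul_zero, zero_mul, le_refl]
  · haveI : NeZero (2 * N - 1) := ⟨by omega⟩
    refine norm_paleySumBilin_le_of_intervals p S₁ S₂ x₁ x₂ N hS₁ hS₂ (2 * N - 1) (by omega)
      (fun z => if z.val + 2 ≤ 2 * N then
        ((legendreSym p (((x₁ : ℤ) + x₂) + (z.val : ℤ)) : ℤ) : ℂ) else 0) ?_ _ ?_ u v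
    · intro s hs
      have hv : ((s : ℕ) : ZMod (2 * N - 1)).val = s := by
        rw [ZMod.val_natCast, Nat.mod_eq_of_lt (by omega)]
      simp only [hv, if_pos hs]
    · intro k
      rw [dft_truncatedKernel p ((x₁ : ℤ) + x₂) N (2 * N - 1) (by omega) k]
      exact norm_twistedSum_offset_le_of_mixedBound p hp2 _ (2 * N - 1) (2 * N - 1) k _ (h p hp N hN)

omit [Fact p.Prime] in
/-- **Sum kernel, ALL sub-pairs of two short intervals** (conditional on `BurgessBoundLinearPhase`): for
`κ, δ₁ > 0`, `κ + (2/3)δ₁ < 1/24`, `p` large, `N ≤ p^{1/2+δ₁}` and ALL `A ⊆ [x₁,x₁+N)`, `B ⊆ [x₂,x₂+N)`: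
`|Σ_{a∈A,b∈B} χ_p(a+b)| ≤ p^{1/2−κ}√(#A#B)`. [cite: HeathBrownPierce2015, Thm 1.4] -/
theorem paleySum_subpairs_two_intervals_of_burgessBoundLinearPhase
    (hBurgess : Literature.NumberTheory.GaussSums.BurgessBoundLinearPhase)
    (κ δ₁ : ℝ) (hκ : 0 < κ) (hδ₁ : 0 < δ₁) (hgap : κ + 2 * δ₁ / 3 < 1 / 24) :
    ∃ p₁ : ℕ, ∀ (p : ℕ) [Fact p.Prime], p₁ ≤ p → ∀ (x₁ x₂ N : ℕ), (N : ℝ) ≤ (p : ℝ) ^ (1 / 2 + δ₁) →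
      ∀ (A B : Finset ℕ), A ⊆ Finset.Ico x₁ (x₁ + N) → B ⊆ Finset.Ico x₂ (x₂ + N) →
        ‖∑ a ∈ A, ∑ b ∈ B, ((legendreSym p ((a : ℤ) + b) : ℤ) : ℂ)‖ ≤
          (p : ℝ) ^ (1 / 2 - κ) * Real.sqrt ((A.card : ℝ) * B.card) := by
  obtain ⟨p₁, h⟩ := paleySumBilin_two_intervals_of_burgessBoundLinearPhase hBurgess κ δ₁ hκ hδ₁ hgap
  refine ⟨p₁, fun p _ hp x₁ x₂ N hN A B hA hB => ?_⟩
  have h1 := h p hp x₁ x₂ N hN A B (fun a ha => Finset.mem_Ico.1 (hA ha)) (fun b hb => Finset.mem_Ico.1 (hB hb))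
    (fun _ => 1) (fun _ => 1)
  simp only [mul_one, norm_one, one_pow, Finset.sum_const, nsmul_eq_mul] at h1
  rw [Real.sqrt_mul (Nat.cast_nonneg _), ← mul_assoc]
  simpa using h1

end Conditional

end

end Summit.ValiantsHypothesis.ValiantsHypothesis.Theorems.FeketeSOSHardPaleyRIP
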